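import Summits.ABC.IUTFork.Cor312VolumesLocal
import Literature.IUT.LogVolume.TensorPacketTransport
import Literature.IUT.LogVolume.TensorPacketShell
import Literature.LinearAlgebra.BaseChange.PiTensorRestrictScalars
import HarnessLib

/-!
# [IUTchIII] Corollary 3.12, statement — the verbatim container at a finite prime on the REAL prime packets;
# the (Ind1)/(Ind2) generator facts PROVED

Record-only file (D-0012) of the abc-iut cell (Cor. 3.12 sub-crew, seat abc-iut-c312-5, gen 2; D-0067 TEAM A row
A-0 «finiteness + BridgeHyps at the real setting»); TAKES NO SIDE. `Cor312VolumesSummands`/`Cor312VolumesLocal`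
type the verbatim mono-analytic container of [IUTchIII] Rmk. 3.1.1 (ii)(iii) (kurims `paper:url-4b091feeb646`
pp. 94–96: direct product regions over the direct SUMMANDS `v⃗`, normalized weighted log-volumes) as data plus the
hypothesis structure `GeneratorsPreserve` (the generators of c312-1's (Ind1)/(Ind2) are intertwined by the
comparison with container-preserving maps). THIS file constructs that data at a nonarchimedean place `v_ℚ = p`
from a `p`-ADIC PRESENTATION of c312-1's log-shell carriers over `v_ℚ` — each `log(𝒟^⊢_v)`, `v | v_ℚ`, IS (as a
`ℚ`-module) a field `K_v` of the cell's MLF class with its normed `ℚ_p`-algebra structure ([IUTchIII] Prop. 1.2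
(vi): the log-shell lives in `k~(G_v) ≅ K_v`) — and PROVES `GeneratorsPreserve` for it:

* summands := abc-iut-c312-3's REAL prime packets `X_{v⃗} = K_{v_0} ⊗_{ℚ_p} ⋯ ⊗_{ℚ_p} K_{v_j}` (`PacketAlgebra`,
  Dupuy–Hilado Def. 3.6.1) with admissibility `PacketAdm` (positive finite normalised Haar measure — the
  property of the printed "compact subsets of positive measure" that the log-measure reads) and log-measure
  `packetLogμ` (`log μ̄_{v⃗}`, `log μ̄(O_{v⃗}) = 0`); comparison `e` := campaign-S `piTensorDistrib ℚ ℚ_[p]` after the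
  presentation ([IUTchIII] Prop. 3.1 (i) "`⊗_α (⊕_v K_v) = ⊕_{v⃗} ⊗_α K_{v_α}`", then `⊗_ℚ → ⊗_{ℚ_p}`), SURJECTIVE
  (`comparison_surjective`), computed on pure tensors by `comparison_tprod`;
* (Ind2) / strip part of (Ind1): a factor-and-summand-wise family `⊗_i ⊕_v g_{i,v}` of `ℚ_p`-linear automorphisms
  preserving the log-shells is intertwined with the SUMMANDWISE family `⊗_{a,ℚ_p} g'_{a,v⃗(a)}` (campaign-S
  naturality `piTensorDistrib_congr`, here re-proved on pure tensors), which lies in c312-3's `indTwo`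
  (`Aut_{ℚ_p}(X_{v⃗} : log_p(R_I^×))`, Dupuy–Hilado §4.9) and therefore preserves `PacketAdm`/`packetLogμ`
  (c312-3's `packetAdm_image_of_mem`/`packetLogμ_image_of_mem` = DH's footnote "the measure of sets are
  preserved" as a THEOREM) — `strip_preserves`, `ism_preserves`;
* the permutation part of (Ind1) (summand permutation `v⃗ ↦ v⃗∘σ⁻¹` with c312-3's `permLinearEquiv`, Dupuy–Hilado
  §4.7) and the assembled `GeneratorsPreserve` are the companion `Cor312VolumesPadicPerm`. [claim: Mochizuki2012, status: disputed] for the quoted container;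
[cite: DupuyHilado2025, §4.7, §4.9] for the (Ind1)/(Ind2) reading; every theorem is bookkeeping over c312-3's
and campaign-S's PROVED transport theorems. Deliberately NOT here: a presentation of a CONCRETE signature
(c312-5's `Real.logShells*`: companion), the image `e(I(^{S^±_{j+1}};𝒟^⊢_{v_ℚ})) = Π_{v⃗} I_{v⃗}` (companion), Θ-boxes,
archimedean places, any judgement.
-/

noncomputable section

open Set Function PiTensorProduct
open scoped TensorProduct Pointwise

namespace Summit.ABC

namespace IUTFork

namespace Cor312Vol

open Thm311 Literature.IUT.LogThetaLattice Literature.IUT.LogVolume Literature.LinearAlgebra.BaseChange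

variable {T : ThetaIndex}

/-- **A `p`-ADIC PRESENTATION of the log-shell carriers over a place `v_ℚ`**: for each `v | v_ℚ` a field `K_v` of
the cell's MLF class (nontrivially normed, normed `ℚ_p`-algebra, ultrametric, proper — abc-iut-c312-3's
`LocalFields` class) and a `ℚ`-linear identification `φ_v : log(𝒟^⊢_v) ≃ K_v` ([IUTchIII] Prop. 1.2 (vi):
`log(𝒟^⊢_v) = k~(G_v)`, a copy of `K_v`), under which the log-shell is a nonzero scalar multiple of `log_p(𝒪^×_{K_v})`
([IUTchIII] Def. 1.1 (i)/Rmk. 1.2.2 (i): `ℐ = (p*)⁻¹·log(𝒪^×)`; Dupuy–Hilado §4: `(1/2p)·log(𝒪^×)`) and the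
strip-automorphisms resp. `Ism`-elements of the signature are `ℚ_p`-LINEAR and PRESERVE THE LOG-SHELL (true for
the bicontinuous lattice isomorphisms of Dupuy–Hilado §4.9 = c312-5's `ismDH`, and for `stripAutDH = {1}`);
together with symmetric nonnegative weights of the summands `v⃗` ([IUTchIII] Rmk. 3.1.1 (ii)). HYPOTHESIS/data
structure; an instance over a concrete signature is the companion's job. [claim: Mochizuki2012, status: disputed] -/
structure PadicPresentation (L : LogShells T) (vQ : T.VQ) (p : ℕ) [Fact p.Prime] : Type 1 where
  /-- the field `K_v`, `v | v_ℚ` -/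
  k : T.Fibre vQ → Type
  /-- nontrivially normed field -/
  [instField : ∀ v, NontriviallyNormedField (k v)]
  /-- normed `ℚ_p`-algebra -/
  [instAlg : ∀ v, NormedAlgebra ℚ_[p] (k v)]
  /-- ultrametric -/
  [instUltra : ∀ v, IsUltrametricDist (k v)]
  /-- proper (locally compact) -/
  [instProper : ∀ v, ProperSpace (k v)]
  /-- the (unique) `ℚ`-module structure -/
  [instRat : ∀ v, Module ℚ (k v)]
  /-- `log(𝒟^⊢_v) ≃ K_v` as `ℚ`-modules -/
  φ : ∀ v, L.carrier v.1 ≃ₗ[ℚ] k v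
  /-- the scalar `(p*)⁻¹` resp. `(2p)⁻¹` -/
  c : ℚ_[p]
  /-- … is nonzero -/
  c_ne_zero : c ≠ 0
  /-- the log-shell is `c·log_p(𝒪^×)` -/
  shell_eq : ∀ v : T.Fibre vQ, φ v '' L.shell v.1 = c • logUnits (k v)
  /-- strip-automorphisms are `ℚ_p`-linear … -/
  strip_linear : ∀ (v : T.Fibre vQ), ∀ g ∈ L.stripAut v.1, ∃ g' : k v ≃ₗ[ℚ_[p]] k v, ∀ x, φ v (g x) = g' (φ v x)
  /-- … and preserve the log-shell -/
  strip_shell : ∀ (v : T.Fibre vQ), ∀ g ∈ L.stripAut v.1, g '' L.shell v.1 = L.shell v.1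
  /-- `Ism`-elements are `ℚ_p`-linear … -/
  ism_linear : ∀ (v : T.Fibre vQ), ∀ g ∈ L.ism v.1, ∃ g' : k v ≃ₗ[ℚ_[p]] k v, ∀ x, φ v (g x) = g' (φ v x)
  /-- … and preserve the log-shell -/
  ism_shell : ∀ (v : T.Fibre vQ), ∀ g ∈ L.ism v.1, g '' L.shell v.1 = L.shell v.1
  /-- the normalized weight of the summand `v⃗` at label `j` -/
  w : ∀ j : T.Label, (T.Caps j → T.Fibre vQ) → ℝ
  /-- … nonnegative -/
  w_nonneg : ∀ j e, 0 ≤ w j e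
  /-- … symmetric under permutations of the capsule index -/
  w_perm : ∀ j (σ : Equiv.Perm (T.Caps j)) e, w j (e ∘ σ) = w j e

namespace PadicPresentation

attribute [instance] instField instAlg instUltra instProper instRat

variable {L : LogShells T} {vQ : T.VQ} {p : ℕ} [Fact p.Prime] (P : PadicPresentation L vQ p)

/-- The fields along a tuple `v⃗ : S^±_{j+1} → {v | v_ℚ}`. [folklore] -/
abbrev kk {j : T.Label} (e : T.Caps j → T.Fibre vQ) : T.Caps j → Type := fun a => P.k (e a)

/-- The REAL summand `X_{v⃗} = K_{v_0} ⊗_{ℚ_p} ⋯ ⊗_{ℚ_p} K_{v_j}` (abc-iut-c312-3 `PacketAlgebra`; Dupuy–Hilado Def. 3.6.1).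
[cite: DupuyHilado2025, Def. 3.6.1] -/
abbrev X {j : T.Label} (e : T.Caps j → T.Fibre vQ) : Type := PacketAlgebra p (P.kk e)

/-! ## The comparison `e : 𝓘^ℚ(^{S^±_{j+1}};𝒟^⊢_{v_ℚ}) → Π_{v⃗} X_{v⃗}` -/

/-- The presentation on 1-packets: `⊕_{v|v_ℚ} log(𝒟^⊢_v) ≃ ⊕_v K_v`. [folklore] -/
def packet1Equiv : L.Packet1 vQ ≃ₗ[ℚ] (∀ v : T.Fibre vQ, P.k v) := LinearEquiv.piCongrRight P.φ

/-- The presentation on `(j+1)`-packets: `⊗_ℚ ⊕_v log(𝒟^⊢_v) ≃ ⊗_ℚ ⊕_v K_v`. [folklore] -/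
def packetEquiv (j : T.Label) : L.Packet j vQ ≃ₗ[ℚ] ⨂[ℚ] _a : T.Caps j, (∀ v : T.Fibre vQ, P.k v) :=
  PiTensorProduct.congr fun _ => P.packet1Equiv

/-- **The comparison map** `e : 𝓘^ℚ(^{S^±_{j+1}};𝒟^⊢_{v_ℚ}) → Π_{v⃗} X_{v⃗}` ([IUTchIII] Prop. 3.1 (i):
`⊗_α (⊕_v K_v) = ⊕_{v⃗} ⊗_α K_{v_α}`, then `⊗_ℚ → ⊗_{ℚ_p}`; campaign-S `piTensorDistrib`). [claim: Mochizuki2012, status: disputed] -/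
def comparison (j : T.Label) : L.Packet j vQ →ₗ[ℚ] ∀ e : T.Caps j → T.Fibre vQ, P.X e :=
  piTensorDistrib ℚ ℚ_[p] (fun (_ : T.Caps j) (v : T.Fibre vQ) => P.k v) ∘ₗ (P.packetEquiv j).toLinearMap

/-- `e` on pure tensors: `e(x_0 ⊗ ⋯ ⊗ x_j)_{v⃗} = ⊗_{ℚ_p, a} φ_{v⃗ a}(x_{a, v⃗ a})`. [folklore] -/
theorem comparison_tprod (j : T.Label) (x : T.Caps j → L.Packet1 vQ) (e : T.Caps j → T.Fibre vQ) :
    P.comparison j (tprod ℚ x) e = tprod ℚ_[p] fun a => P.φ (e a) (x a (e a)) := by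
  have h1 : P.packetEquiv j (tprod ℚ x) = tprod ℚ fun a => P.packet1Equiv (x a) :=
    PiTensorProduct.congr_tprod _ _
  unfold comparison
  rw [LinearMap.comp_apply, LinearEquiv.coe_coe, h1, piTensorDistrib_tprod]
  rfl

/-- **`e` is onto** (`⊗_ℚ ⊕ K_v → ⊕_{v⃗} ⊗_{ℚ_p} K_{v⃗}` is surjective: campaign-S `piTensorDistrib_surjective`).
[claim: Mochizuki2012, status: disputed] -/
theorem comparison_surjective (j : T.Label) : Function.Surjective (P.comparison j) := by
  classical
  haveI : Fintype (T.Fibre vQ) := Fintype.ofFinite _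
  unfold comparison
  rw [LinearMap.coe_comp]
  exact (piTensorDistrib_surjective ℚ ℚ_[p] _).comp (P.packetEquiv j).surjective

/-! ## The local pieces -/

/-- An admissible subset of a real summand is nonempty (its measure is positive). [folklore] -/
theorem packetAdm_nonempty {j : T.Label} (e : T.Caps j → T.Fibre vQ) (R : Set (P.X e))
    (hR : PacketAdm p (P.kk e) R) : R.Nonempty := by
  by_contra h
  rw [Set.not_nonempty_iff_eq_empty] at h
  have h0 := hR.1
  rw [h, packetVol, Set.image_empty, MeasureTheory.measure_empty] at h0
  exact lt_irrefl _ h0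

/-- **The verbatim local pieces at `v_ℚ = p` on the REAL prime packets**: summands `X_{v⃗}` indexed by the tuples
`v⃗ ∈ Π_{α∈S^±_{j+1}} 𝕍_{v_ℚ}` ([IUTchIII] Rmk. 3.1.1 (iii) p. 95–96), admissibility `PacketAdm`, log-measure
`packetLogμ` (Dupuy–Hilado Def. 3.6.1), comparison `e`, weights `w`. [claim: Mochizuki2012, status: disputed] -/
def toLocalPieces : LocalPieces L vQ where
  E j := T.Caps j → T.Fibre vQ
  instFintype _ := Fintype.ofFinite _
  X _ e := P.X e
  adm _ e := PacketAdm p (P.kk e)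
  logμ _ e := packetLogμ p (P.kk e)
  adm_nonempty _ e R hR := P.packetAdm_nonempty e R hR
  logμ_mono _ e _ _ hR hR' h := packetLogμ_mono p (P.kk e) hR hR' h
  e j := P.comparison j
  e_surjective j := P.comparison_surjective j
  w := P.w
  w_nonneg := P.w_nonneg

/-! ## (Ind2) and the strip part of (Ind1): summandwise `indTwo`-families -/

section Factorwise

variable {j : T.Label}

/-- A `ℚ_p`-linear automorphism of `K_v` intertwined with a shell-preserving automorphism of `log(𝒟^⊢_v)` maps
`log_p(𝒪^×)` onto itself. [folklore] -/
theorem image_logUnits_eq {v : T.Fibre vQ} {g : L.carrier v.1 ≃ₗ[ℚ] L.carrier v.1} {g' : P.k v ≃ₗ[ℚ_[p]] P.k v}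
    (hg' : ∀ x, P.φ v (g x) = g' (P.φ v x)) (hshell : g '' L.shell v.1 = L.shell v.1) :
    g' '' logUnits (P.k v) = logUnits (P.k v) := by
  have h1 : g' '' (P.φ v '' L.shell v.1) = P.φ v '' L.shell v.1 := by
    conv_rhs => rw [← hshell]
    rw [Set.image_image, Set.image_image]
    exact Set.image_congr fun x _ => (hg' x).symm
  have h2 : g' '' (P.c • logUnits (P.k v)) = P.c • (g' '' logUnits (P.k v)) := by
    rw [← Set.image_smul, ← Set.image_smul, Set.image_image, Set.image_image]
    exact Set.image_congr fun x _ => map_smul g' P.c x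
  rw [P.shell_eq v, h2] at h1
  have h3 := congrArg (fun S : Set (P.k v) => P.c⁻¹ • S) h1
  simpa only [inv_smul_smul₀ P.c_ne_zero] using h3

/-- The summandwise map `⊗_{a,ℚ_p} g'_{a,v⃗(a)}` induced by `ℚ_p`-linear automorphisms preserving `log_p(𝒪^×)` lies
in c312-3's (Ind2)-group `indTwo` of the real summand (it maps `log_p(R_I^×)` onto itself).
[cite: DupuyHilado2025, §4.9] -/
theorem congr_mem_indTwo (e : T.Caps j → T.Fibre vQ) (g' : ∀ a, P.k (e a) ≃ₗ[ℚ_[p]] P.k (e a))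
    (hg' : ∀ a, g' a '' logUnits (P.k (e a)) = logUnits (P.k (e a))) :
    (PiTensorProduct.congr g' : P.X e ≃ₗ[ℚ_[p]] P.X e) ∈ indTwo p (P.kk e) := by
  apply mem_indTwo_of_image_eq
  set S : Set (P.X e) :=
    {t | ∃ z : ∀ a, P.kk e a, (∀ a, z a ∈ logUnits (P.kk e a)) ∧ t = purePacket p (P.kk e) z} with hSdef
  set ψ : P.X e ≃ₗ[ℚ_[p]] P.X e := PiTensorProduct.congr g'
  have hS : ψ '' S = S := by
    apply Set.Subset.antisymm
    · rintro _ ⟨_, ⟨z, hz, rfl⟩, rfl⟩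
      refine ⟨fun a => g' a (z a), fun a => ?_, ?_⟩
      · rw [← hg' a]; exact ⟨z a, hz a, rfl⟩
      · simp [ψ, purePacket, PiTensorProduct.congr_tprod]
    · rintro _ ⟨z, hz, rfl⟩
      have hz' : ∀ a, ∃ y, y ∈ logUnits (P.kk e a) ∧ g' a y = z a := fun a => by
        have : z a ∈ g' a '' logUnits (P.k (e a)) := by rw [hg' a]; exact hz a
        exact this
      choose y hy hgy using hz'
      refine ⟨purePacket p (P.kk e) y, ⟨y, hy, rfl⟩, ?_⟩
      simp [ψ, purePacket, PiTensorProduct.congr_tprod, hgy]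
  have hmap : ψ '' (logPacket p (P.kk e) : Set (P.X e)) =
      ((logPacket p (P.kk e)).map ψ.toLinearMap.toAddMonoidHom : Set (P.X e)) :=
    (AddSubgroup.coe_map _ _).symm
  rw [hmap]
  unfold logPacket
  rw [AddMonoidHom.map_closure]
  exact congrArg (fun U : Set (P.X e) => ((AddSubgroup.closure U : AddSubgroup (P.X e)) : Set (P.X e))) hS

/-- **Factor-and-summand-wise families are intertwined with summandwise `indTwo`-families**: for `g_{i,v}`
intertwined through `φ` with `ℚ_p`-linear `g'_{i,v}` preserving `log_p(𝒪^×)`,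
`e(⊗_i ⊕_v g_{i,v} · x)_{v⃗} = (⊗_{a,ℚ_p} g'_{a,v⃗ a})(e(x)_{v⃗})`, and the latter family preserves the container.
[cite: DupuyHilado2025, §4.9] -/
theorem factorwise_preserves (g : T.Caps j → ∀ v : T.Fibre vQ, L.carrier v.1 ≃ₗ[ℚ] L.carrier v.1)
    (g' : T.Caps j → ∀ v : T.Fibre vQ, P.k v ≃ₗ[ℚ_[p]] P.k v)
    (hg' : ∀ i v x, P.φ v (g i v x) = g' i v (P.φ v x))
    (hlog : ∀ i v, g' i v '' logUnits (P.k v) = logUnits (P.k v)) :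
    ∃ Ψ, P.toLocalPieces.PreservesRegions j Ψ ∧
      ∀ x, P.comparison j (L.factorwise j vQ (fun i => L.summandwise vQ (g i)) x) = Ψ (P.comparison j x) := by
  -- the summandwise family
  let ψ : ∀ e : T.Caps j → T.Fibre vQ, P.X e ≃ₗ[ℚ_[p]] P.X e :=
    fun e => PiTensorProduct.congr fun a => g' a (e a)
  have hψ : ∀ e, ψ e ∈ indTwo p (P.kk e) := fun e => P.congr_mem_indTwo e _ fun a => hlog a (e a)
  refine ⟨Pi.map fun e => ⇑(ψ e), ?_, fun x => ?_⟩
  · refine LocalPieces.PreservesRegions.summandwise P.toLocalPieces (fun e => (ψ e).toEquiv) ?_ ?_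
    · intro e R
      show PacketAdm p (P.kk e) (ψ e '' R) ↔ PacketAdm p (P.kk e) R
      unfold PacketAdm
      rw [packetVol_image_of_mem p (P.kk e) (hψ e) R]
    · exact fun e R _ => packetLogμ_image_of_mem p (P.kk e) (hψ e) R
  · -- naturality: two `ℚ`-linear maps agreeing on pure tensors
    funext e
    have key : (LinearMap.proj e ∘ₗ P.comparison j) ∘ₗ
          (L.factorwise j vQ (fun i => L.summandwise vQ (g i))).toLinearMap =
        ((ψ e).toLinearMap.restrictScalars ℚ) ∘ₗ (LinearMap.proj e ∘ₗ P.comparison j) := by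
      refine PiTensorProduct.ext (MultilinearMap.ext fun y => ?_)
      simp only [LinearMap.compMultilinearMap_apply]
      change P.comparison j (L.factorwise j vQ (fun i => L.summandwise vQ (g i)) (L.tprod j vQ y)) e =
        ψ e (P.comparison j (tprod ℚ y) e)
      rw [L.factorwise_summandwise_tprod]
      change P.comparison j (tprod ℚ fun i => fun v => g i v (y i v)) e = _
      rw [comparison_tprod, comparison_tprod]
      simp only [ψ, PiTensorProduct.congr_tprod]
      exact congrArg _ (funext fun a => hg' a (e a) (y a (e a)))
    exact LinearMap.congr_fun key x

/-- **(Ind2) preserves the verbatim container** at `v_ℚ = p`. [cite: DupuyHilado2025, §4.9] -/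
theorem ism_preserves (g : T.Caps j → ∀ v : T.Fibre vQ, L.carrier v.1 ≃ₗ[ℚ] L.carrier v.1)
    (hg : ∀ i v, g i v ∈ L.ism v.1) :
    ∃ Ψ, P.toLocalPieces.PreservesRegions j Ψ ∧
      ∀ x, P.comparison j (L.factorwise j vQ (fun i => L.summandwise vQ (g i)) x) = Ψ (P.comparison j x) := by
  choose g' hg' using fun i v => P.ism_linear v (g i v) (hg i v)
  exact P.factorwise_preserves g g' hg' fun i v => P.image_logUnits_eq (hg' i v) (P.ism_shell v _ (hg i v))

/-- **The strip part of (Ind1) preserves the verbatim container** at `v_ℚ = p`. [cite: DupuyHilado2025, §4.7] -/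
theorem strip_preserves (g : T.Caps j → ∀ v : T.Fibre vQ, L.carrier v.1 ≃ₗ[ℚ] L.carrier v.1)
    (hg : ∀ i v, g i v ∈ L.stripAut v.1) :
    ∃ Ψ, P.toLocalPieces.PreservesRegions j Ψ ∧
      ∀ x, P.comparison j (L.factorwise j vQ (fun i => L.summandwise vQ (g i)) x) = Ψ (P.comparison j x) := by
  choose g' hg' using fun i v => P.strip_linear v (g i v) (hg i v)
  exact P.factorwise_preserves g g' hg' fun i v => P.image_logUnits_eq (hg' i v) (P.strip_shell v _ (hg i v))

end Factorwise

end PadicPresentation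

end Cor312Vol

end IUTFork

end Summit.ABC

end
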